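import Summits.HubbardSuperconductivity.HubbardSuperconductivity.Theorems.AnisotropyChordStiffnessFarFieldInteraction

/-!
# Route `AnisotropyChord` / H0 rotor rung: STUB K2 `FarFieldKernelDecay` PROVED — the Lieb–Robinson far field of the
# filtered current kernel (theory seat memo ROTOR-THEORY-8 §123; Sketch8 Parts AB–AC ported)

Interaction norm `J ≤ 4(1+|Δ|)` (`hcbInteraction_norm_sum_le`), incident-edge count, bond-current support and commutator
norm, the Lieb–Robinson grading at a bond (`lrGrade`, `lrGrade_disjoint/step/bond_ge`), **`bondCurrentLiebRobinson_holds :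
BondCurrentLiebRobinson Δ`** (constants `C₀ = 2e²`, `μ = 1`, `v₀ = 16e(1+|Δ|)`, from the tree's
`norm_comm_heisenbergEvolution_le_exp`), and **`farFieldKernelDecay_holds : ∀ Δ M, FarFieldKernelDecay Δ M`**
(`c = 2`, `v = 16e(1+|Δ|)`, `μ = 1`, `C_LR = e²`).
Typing/proof authority: theory seat `hubbard-h0-rotor-theory-1`, cycle 8 (ported verbatim up to namespaces).
-/


set_option linter.dupNamespace false

noncomputable section

open Matrix Complex Finset Filter Topology MeasureTheory
open scoped ComplexConjugate Matrix.Norms.L2Operator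
open Literature.MathematicalPhysics.QuantumLattice hiding torusPhase torusNorm
open Literature.Probability.LatticeModels
open Summit.HubbardSuperconductivity.HubbardSuperconductivity.Theorems.AnisotropyChord.InsertionEntropy

namespace Summit.HubbardSuperconductivity.HubbardSuperconductivity.Theorems.AnisotropyChord.Stiffness

/-! ## (port of Sketch8 section LRConstants) -/


/-- `‖(S^α_x S^α_y)_{sym}‖ ≤ 1/4` for spin ½ (operator norm). -/
theorem norm_spinBond_le (L : ℕ) [NeZero L] (α : Fin 3) (x y : TorusSite 2 L) :
    ‖(spinBond 1 α x y : Op (TorusSite 2 L) 2)‖ ≤ 1 / 4 := by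
  have hS : ∀ (z : TorusSite 2 L) (β : Fin 3), ‖(siteSpin 1 z β : Op (TorusSite 2 L) 2)‖ ≤ 1 / 2 := by
    intro z β
    have h := norm_siteSpin_le' (Λ := TorusSite 2 L) 1 z β
    norm_num at h
    exact h
  have hP : ∀ (u v : TorusSite 2 L),
      ‖(siteSpin 1 u α * siteSpin 1 v α : Op (TorusSite 2 L) 2)‖ ≤ 1 / 4 := by
    intro u v
    refine (norm_mul_le _ _).trans ?_
    nlinarith [hS u α, hS v α, norm_nonneg (siteSpin 1 u α : Op (TorusSite 2 L) 2),
      norm_nonneg (siteSpin 1 v α : Op (TorusSite 2 L) 2)]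
  unfold spinBond
  rw [norm_smul]
  have hc : ‖(1 / 2 : ℂ)‖ = 1 / 2 := by simp
  rw [hc]
  have := (norm_add_le (siteSpin 1 x α * siteSpin 1 y α : Op (TorusSite 2 L) 2)
    (siteSpin 1 y α * siteSpin 1 x α)).trans (add_le_add (hP x y) (hP y x))
  linarith

/-- `‖h_e‖ ≤ 1 + |Δ|`. -/
theorem norm_bondTerm_le (L : ℕ) [NeZero L] (Δ : ℝ) (e : Sym2 (TorusSite 2 L)) :
    ‖bondTerm L Δ e‖ ≤ 1 + |Δ| := by
  induction e using Sym2.ind with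
  | h x y =>
    show ‖(spinBond 1 0 x y + spinBond 1 1 x y + (Δ : ℂ) • spinBond 1 2 x y : Op (TorusSite 2 L) 2)‖ ≤ _
    have hΔ : ‖(Δ : ℂ)‖ = |Δ| := by simp
    have h0 := norm_spinBond_le L 0 x y
    have h1 := norm_spinBond_le L 1 x y
    have h2 := norm_spinBond_le L 2 x y
    have h3 : ‖((Δ : ℂ) • spinBond 1 2 x y : Op (TorusSite 2 L) 2)‖ ≤ |Δ| * (1 / 4) := by
      rw [norm_smul, hΔ]; exact mul_le_mul_of_nonneg_left h2 (abs_nonneg _)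
    refine (norm_add_le _ _).trans ((add_le_add ((norm_add_le _ _).trans (add_le_add h0 h1)) h3).trans ?_)
    nlinarith [abs_nonneg Δ]

/-- Membership in `edgeSupport`. -/
theorem mem_edgeSupport (L : ℕ) [NeZero L] (e : Sym2 (TorusSite 2 L)) (z : TorusSite 2 L) :
    z ∈ edgeSupport L e ↔ z ∈ e := by
  simp [edgeSupport]

/-- At most `4` edges of `𝕋²_L` contain a given site. -/
theorem card_incident_le (L : ℕ) [NeZero L] (z : TorusSite 2 L) :
    ((torusGraph 2 L).edgeFinset.filter fun e => z ∈ e).card ≤ 4 := by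
  have hsub : ((torusGraph 2 L).edgeFinset.filter fun e => z ∈ e)
      ⊆ (Finset.univ.filter fun v => (torusGraph 2 L).Adj z v).image (fun v => s(z, v)) := by
    intro e he
    rw [Finset.mem_filter] at he
    obtain ⟨he, hz⟩ := he
    refine Finset.mem_image.mpr ⟨Sym2.Mem.other hz, ?_, Sym2.other_spec hz⟩
    refine Finset.mem_filter.mpr ⟨Finset.mem_univ _, ?_⟩
    have h' : s(z, Sym2.Mem.other hz) ∈ (torusGraph 2 L).edgeSet := by
      rw [Sym2.other_spec hz]; exact SimpleGraph.mem_edgeFinset.mp he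
    exact (SimpleGraph.mem_edgeSet (torusGraph 2 L)).mp h'
  calc _ ≤ _ := Finset.card_le_card hsub
    _ ≤ _ := Finset.card_image_le
    _ ≤ 2 * 2 := card_filter_adj_le z

/-- **LR constant J.** `Σ_{Z ∋ z} ‖Φ Z‖ ≤ 4(1 + |Δ|)`. -/
theorem hcbInteraction_norm_sum_le (L : ℕ) [NeZero L] (Δ : ℝ) (z : TorusSite 2 L) :
    ∑ Z ∈ Finset.univ.filter (fun Z : Finset (TorusSite 2 L) => z ∈ Z), ‖hcbInteraction L Δ Z‖
      ≤ 4 * (1 + |Δ|) := by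
  have h1 : ∀ Z, ‖hcbInteraction L Δ Z‖
      ≤ ∑ e ∈ (torusGraph 2 L).edgeFinset with edgeSupport L e = Z, ‖bondTerm L Δ e‖ := by
    intro Z; unfold hcbInteraction
    rw [norm_smul, show ‖((-1 : ℝ) : ℂ)‖ = 1 by simp, one_mul]
    exact norm_sum_le _ _
  have h2 : ∀ Z ∈ Finset.univ.filter (fun Z : Finset (TorusSite 2 L) => z ∈ Z),
      (∑ e ∈ (torusGraph 2 L).edgeFinset with edgeSupport L e = Z, ‖bondTerm L Δ e‖)
        = ∑ e ∈ ((torusGraph 2 L).edgeFinset.filter fun e => z ∈ e) with edgeSupport L e = Z,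
            ‖bondTerm L Δ e‖ := by
    intro Z hZ
    rw [Finset.mem_filter] at hZ
    refine Finset.sum_congr ?_ fun _ _ => rfl
    ext e
    simp only [Finset.mem_filter]
    constructor
    · rintro ⟨he, hs⟩
      refine ⟨⟨he, ?_⟩, hs⟩
      have := hZ.2
      rw [← hs, mem_edgeSupport] at this
      exact this
    · rintro ⟨⟨he, _⟩, hs⟩; exact ⟨he, hs⟩
  calc ∑ Z ∈ Finset.univ.filter (fun Z : Finset (TorusSite 2 L) => z ∈ Z), ‖hcbInteraction L Δ Z‖
      ≤ ∑ Z ∈ Finset.univ.filter (fun Z : Finset (TorusSite 2 L) => z ∈ Z),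
          ∑ e ∈ ((torusGraph 2 L).edgeFinset.filter fun e => z ∈ e) with edgeSupport L e = Z,
            ‖bondTerm L Δ e‖ := by
        refine Finset.sum_le_sum fun Z hZ => ?_
        rw [← h2 Z hZ]; exact h1 Z
    _ = ∑ e ∈ ((torusGraph 2 L).edgeFinset.filter fun e => z ∈ e), ‖bondTerm L Δ e‖ := by
        refine Finset.sum_fiberwise_of_maps_to (fun e he => ?_) _
        rw [Finset.mem_filter] at he
        exact Finset.mem_filter.mpr ⟨Finset.mem_univ _, (mem_edgeSupport L e z).mpr he.2⟩
    _ ≤ ∑ _e ∈ ((torusGraph 2 L).edgeFinset.filter fun e => z ∈ e), (1 + |Δ|) :=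
        Finset.sum_le_sum fun e _ => norm_bondTerm_le L Δ e
    _ = (((torusGraph 2 L).edgeFinset.filter fun e => z ∈ e).card : ℝ) * (1 + |Δ|) := by
        rw [Finset.sum_const, nsmul_eq_mul]
    _ ≤ 4 * (1 + |Δ|) := by
        have : (((torusGraph 2 L).edgeFinset.filter fun e => z ∈ e).card : ℝ) ≤ 4 := by
          exact_mod_cast card_incident_le L z
        exact mul_le_mul_of_nonneg_right this (by positivity)

/-- The bond current `j_{x, x+e_j}` is supported on its bond. -/
theorem bondJ_isSupportedOn (L : ℕ) [NeZero L] (x : TorusSite 2 L) (j : Fin 2) :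
    IsSupportedOn (bondJ L x j) ({x, x + Pi.single j 1} : Finset (TorusSite 2 L)) := by
  have hx : ∀ α, IsSupportedOn (siteSpin 1 x α : Op (TorusSite 2 L) 2)
      ({x, x + Pi.single j 1} : Finset _) :=
    fun α => IsSupportedOn.mono_holds (isSupportedOn_onSite_holds x _) (by simp)
  have hy : ∀ α, IsSupportedOn (siteSpin 1 (x + Pi.single j 1) α : Op (TorusSite 2 L) 2)
      ({x, x + Pi.single j 1} : Finset _) :=
    fun α => IsSupportedOn.mono_holds (isSupportedOn_onSite_holds (x + Pi.single j 1) _) (by simp)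
  have h : (siteSpin 1 x 0 * siteSpin 1 (x + Pi.single j 1) 1
      - siteSpin 1 x 1 * siteSpin 1 (x + Pi.single j 1) 0 : Op (TorusSite 2 L) 2)
      = siteSpin 1 x 0 * siteSpin 1 (x + Pi.single j 1) 1
        + (-1 : ℂ) • (siteSpin 1 x 1 * siteSpin 1 (x + Pi.single j 1) 0) := by
    rw [neg_one_smul, sub_eq_add_neg]
  show IsSupportedOn ((-Complex.I) • (siteSpin 1 x 0 * siteSpin 1 (x + Pi.single j 1) 1
      - siteSpin 1 x 1 * siteSpin 1 (x + Pi.single j 1) 0)) _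
  rw [h]
  exact ((IsSupportedOn.mul_holds (hx 0) (hy 1)).add
    ((IsSupportedOn.mul_holds (hx 1) (hy 0)).smul _)).smul _

/-- The trivial commutator bound `‖[j_b, τ_t(j_{b'})]‖ ≤ 2`. -/
theorem norm_comm_bondJ_le_two (L : ℕ) [NeZero L] (Δ : ℝ) (x : TorusSite 2 L) (j : Fin 2)
    (y : TorusSite 2 L) (j' : Fin 2) (t : ℝ) :
    ‖bondJ L x j * heisenbergEvolution (hcbHamiltonian L Δ) t (bondJ L y j')
      - heisenbergEvolution (hcbHamiltonian L Δ) t (bondJ L y j') * bondJ L x j‖ ≤ 2 := by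
  have hA : ‖heisenbergEvolution (hcbHamiltonian L Δ) t (bondJ L y j')‖ ≤ 1 := by
    rw [norm_heisenbergEvolution_holds (hcbHamiltonian_isHermitian L Δ) t]
    exact norm_bondCurrent_le L _ _
  have hB : ‖bondJ L x j‖ ≤ 1 := norm_bondCurrent_le L _ _
  refine (norm_sub_le _ _).trans ?_
  have h1 := norm_mul_le (bondJ L x j) (heisenbergEvolution (hcbHamiltonian L Δ) t (bondJ L y j'))
  have h2 := norm_mul_le (heisenbergEvolution (hcbHamiltonian L Δ) t (bondJ L y j')) (bondJ L x j)
  nlinarith [norm_nonneg (bondJ L x j),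
    norm_nonneg (heisenbergEvolution (hcbHamiltonian L Δ) t (bondJ L y j'))]


/-! ## (port of Sketch8 section LRAssembly) -/


/-- The LR grading at the site `x`: `δ_x(Z) = dist(x, Z) - 1` (`0` for `Z = ∅`). -/
def lrGrade (L : ℕ) [NeZero L] (x : TorusSite 2 L) (Z : Finset (TorusSite 2 L)) : ℕ :=
  if h : Z.Nonempty then Z.inf' h (fun z => torusDist (Ls := fun _ : Fin 2 => L) x z) - 1 else 0

/-- The two sites of a bond are at torus distance `≤ 1`. -/
theorem torusDist_bond_le_one (L : ℕ) [NeZero L] (x : TorusSite 2 L) (j : Fin 2) :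
    torusDist (Ls := fun _ : Fin 2 => L) x (x + Pi.single j 1) ≤ 1 := by
  by_cases hL : 2 ≤ L
  · exact torusDist_le_one_of_adj
      ((torusGraph_adj_iff _ _).mpr ⟨bond_ne L hL x j, Or.inl ⟨j, rfl⟩⟩)
  · have := torusDist_lt x (x + Pi.single j 1); omega

/-- (a) positive grade ⇒ disjoint from the bond at `x`. -/
theorem lrGrade_disjoint (L : ℕ) [NeZero L] (x : TorusSite 2 L) (j : Fin 2)
    (Z : Finset (TorusSite 2 L)) (h : 0 < lrGrade L x Z) :
    Disjoint Z ({x, x + Pi.single j 1} : Finset (TorusSite 2 L)) := by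
  rw [Finset.disjoint_left]
  intro z hzZ hzY
  have hne : Z.Nonempty := ⟨z, hzZ⟩
  unfold lrGrade at h
  rw [dif_pos hne] at h
  have hinf : Z.inf' hne (fun z => torusDist (Ls := fun _ : Fin 2 => L) x z)
      ≤ torusDist (Ls := fun _ : Fin 2 => L) x z := Finset.inf'_le _ hzZ
  have hDz : torusDist (Ls := fun _ : Fin 2 => L) x z ≤ 1 := by
    rw [Finset.mem_insert, Finset.mem_singleton] at hzY
    rcases hzY with rfl | rfl
    · simp
    · exact torusDist_bond_le_one L _ j
  omega

/-- (b) the grading changes by at most one across an interaction term. -/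
theorem lrGrade_step (L : ℕ) [NeZero L] (Δ : ℝ) (x : TorusSite 2 L)
    (Z Z' : Finset (TorusSite 2 L)) (hZ' : hcbInteraction L Δ Z' ≠ 0) (hZZ : ¬ Disjoint Z' Z) :
    lrGrade L x Z ≤ lrGrade L x Z' + 1 := by
  have hex : ∃ e ∈ (torusGraph 2 L).edgeFinset, edgeSupport L e = Z' := by
    by_contra hne
    push Not at hne
    exact hZ' (hcbInteraction_eq_zero_of_not_edge L Δ Z' hne)
  obtain ⟨e, he, hsupp⟩ := hex
  obtain ⟨z₀, hz₀Z', hz₀Z⟩ := Finset.not_disjoint_iff.mp hZZ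
  have hneZ : Z.Nonempty := ⟨z₀, hz₀Z⟩
  have hneZ' : Z'.Nonempty := ⟨z₀, hz₀Z'⟩
  -- any two points of Z' are within distance 1
  have hdiam : ∀ w ∈ Z', ∀ w' ∈ Z', torusDist (Ls := fun _ : Fin 2 => L) w w' ≤ 1 := by
    intro w hw w' hw'
    revert he hsupp
    induction e using Sym2.ind with
    | h u v =>
      intro he hsupp
      have hadj : (torusGraph 2 L).Adj u v :=
        (SimpleGraph.mem_edgeSet (torusGraph 2 L)).mp (SimpleGraph.mem_edgeFinset.mp he)
      rw [← hsupp, edgeSupport_mk, Finset.mem_insert, Finset.mem_singleton] at hw hw'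
      have h1 := torusDist_le_one_of_adj hadj
      have h2 : torusDist (Ls := fun _ : Fin 2 => L) v u ≤ 1 := by rw [torusDist_comm']; exact h1
      rcases hw with rfl | rfl <;> rcases hw' with rfl | rfl <;> simp [h1, h2]
  unfold lrGrade
  rw [dif_pos hneZ, dif_pos hneZ']
  have hA : Z.inf' hneZ (fun z => torusDist (Ls := fun _ : Fin 2 => L) x z)
      ≤ torusDist (Ls := fun _ : Fin 2 => L) x z₀ := Finset.inf'_le _ hz₀Z
  have hB : torusDist (Ls := fun _ : Fin 2 => L) x z₀ - 1
      ≤ Z'.inf' hneZ' (fun z => torusDist (Ls := fun _ : Fin 2 => L) x z) := by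
    rw [Finset.le_inf'_iff]
    intro w hw
    have ht := torusDist_triangle' (Ls := fun _ : Fin 2 => L) x w z₀
    have hw1 := hdiam w hw z₀ hz₀Z'
    omega
  omega

/-- (c) the grade of the far bond: `dist(x,y) ≤ δ_x({y, y+e}) + 2`. -/
theorem lrGrade_bond_ge (L : ℕ) [NeZero L] (x y : TorusSite 2 L) (j' : Fin 2) :
    torusDist (Ls := fun _ : Fin 2 => L) x y
      ≤ lrGrade L x ({y, y + Pi.single j' 1} : Finset (TorusSite 2 L)) + 2 := by
  have hne : ({y, y + Pi.single j' 1} : Finset (TorusSite 2 L)).Nonempty := ⟨y, by simp⟩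
  unfold lrGrade
  rw [dif_pos hne]
  have hB : torusDist (Ls := fun _ : Fin 2 => L) x y - 1
      ≤ ({y, y + Pi.single j' 1} : Finset (TorusSite 2 L)).inf' hne
          (fun z => torusDist (Ls := fun _ : Fin 2 => L) x z) := by
    rw [Finset.le_inf'_iff]
    intro w hw
    rw [Finset.mem_insert, Finset.mem_singleton] at hw
    rcases hw with hw | hw <;> rw [hw]
    · omega
    · have ht := torusDist_triangle' (Ls := fun _ : Fin 2 => L) x (y + Pi.single j' 1) y
      have h1 : torusDist (Ls := fun _ : Fin 2 => L) (y + Pi.single j' 1) y ≤ 1 := by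
        rw [torusDist_comm']; exact torusDist_bond_le_one L y j'
      omega
  omega

/-- **K2-LR PROVED** (`C₀ = 2e²`, `μ = 1`, `v₀ = 16 e (1 + |Δ|)`). -/
theorem bondCurrentLiebRobinson_holds (Δ : ℝ) : BondCurrentLiebRobinson Δ := by
  refine ⟨2 * Real.exp 2, by positivity, 1, one_pos, 16 * Real.exp 1 * (1 + |Δ|), by positivity, ?_⟩
  intro L _ x j y j' t
  refine le_min (norm_comm_bondJ_le_two L Δ x j y j' t) ?_
  by_cases hd : 3 ≤ torusDist (Ls := fun _ : Fin 2 => L) x y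
  · -- Lieb–Robinson branch
    have hJ0 : (0 : ℝ) ≤ 4 * (1 + |Δ|) := by positivity
    have hX : 0 < lrGrade L x ({y, y + Pi.single j' 1} : Finset (TorusSite 2 L)) := by
      have := lrGrade_bond_ge L x y j'; omega
    have hLR := norm_comm_heisenbergEvolution_le_exp (hcbInteraction_isLocal L Δ)
      (bondJ_isSupportedOn L y j') (bondJ_isSupportedOn L x j) (lrGrade L x)
      (fun Z hZ => lrGrade_disjoint L x j Z hZ) (fun Z Z' hZ' hZZ => lrGrade_step L Δ x Z Z' hZ' hZZ)
      hX hJ0 (hcbInteraction_norm_sum_le L Δ) (V := 2) (by norm_num)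
      (hcbInteraction_card_le L Δ) (μ := 1) zero_le_one t
    rw [localHamiltonian_hcbInteraction] at hLR
    rw [← norm_neg, neg_sub]
    refine hLR.trans ?_
    have hA : ‖bondJ L y j'‖ ≤ 1 := norm_bondCurrent_le L _ _
    have hB : ‖bondJ L x j‖ ≤ 1 := norm_bondCurrent_le L _ _
    have hcard : ((({y, y + Pi.single j' 1} : Finset (TorusSite 2 L)).card : ℕ) : ℝ) ≤ 2 := by
      exact_mod_cast Finset.card_le_two
    have hpre : 2 * ‖bondJ L y j'‖ * ‖bondJ L x j‖
        * ((({y, y + Pi.single j' 1} : Finset (TorusSite 2 L)).card : ℝ) / (2 : ℕ)) ≤ 2 := by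
      have h1 : ‖bondJ L y j'‖ * ‖bondJ L x j‖ ≤ 1 := by
        nlinarith [norm_nonneg (bondJ L y j'), norm_nonneg (bondJ L x j)]
      have h2 : ((({y, y + Pi.single j' 1} : Finset (TorusSite 2 L)).card : ℝ) / (2 : ℕ)) ≤ 1 := by
        rw [div_le_one (by norm_num)]; exact_mod_cast Finset.card_le_two
      have h3 : 0 ≤ ((({y, y + Pi.single j' 1} : Finset (TorusSite 2 L)).card : ℝ) / (2 : ℕ)) := by
        positivity
      nlinarith [norm_nonneg (bondJ L y j'), norm_nonneg (bondJ L x j)]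
    have hgrade : (torusDist (Ls := fun _ : Fin 2 => L) x y : ℝ)
        ≤ (lrGrade L x ({y, y + Pi.single j' 1} : Finset (TorusSite 2 L)) : ℝ) + 2 := by
      exact_mod_cast lrGrade_bond_ge L x y j'
    have hexp : Real.exp (-(1 * (lrGrade L x ({y, y + Pi.single j' 1} : Finset (TorusSite 2 L)) : ℝ))
        + 2 * Real.exp 1 * (2 : ℕ) * (4 * (1 + |Δ|)) * |t|)
        ≤ Real.exp 2 * Real.exp (-(1 * tdist L x y) + 16 * Real.exp 1 * (1 + |Δ|) * |t|) := by
      rw [← Real.exp_add]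
      refine Real.exp_le_exp.mpr ?_
      unfold tdist
      push_cast
      nlinarith [hgrade]
    calc _ ≤ 2 * (Real.exp 2 * Real.exp (-(1 * tdist L x y) + 16 * Real.exp 1 * (1 + |Δ|) * |t|)) :=
          mul_le_mul hpre hexp (Real.exp_pos _).le (by norm_num)
      _ = _ := by ring
  · -- near bonds: the trivial bound already beats the claimed one
    have hd' : tdist L x y ≤ 2 := by
      unfold tdist; exact_mod_cast (by omega : torusDist (Ls := fun _ : Fin 2 => L) x y ≤ 2)
    have h1 : Real.exp (-2) ≤ Real.exp (-(1 * tdist L x y) + 16 * Real.exp 1 * (1 + |Δ|) * |t|) := by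
      refine Real.exp_le_exp.mpr ?_
      have : 0 ≤ 16 * Real.exp 1 * (1 + |Δ|) * |t| := by positivity
      linarith
    have h2 : Real.exp 2 * Real.exp (-2) = 1 := by rw [← Real.exp_add]; norm_num
    calc ‖bondJ L x j * heisenbergEvolution (hcbHamiltonian L Δ) t (bondJ L y j')
          - heisenbergEvolution (hcbHamiltonian L Δ) t (bondJ L y j') * bondJ L x j‖
        ≤ 2 := norm_comm_bondJ_le_two L Δ x j y j' t
      _ = 2 * Real.exp 2 * Real.exp (-2) := by rw [mul_assoc, h2, mul_one]
      _ ≤ 2 * Real.exp 2 * Real.exp (-(1 * tdist L x y) + 16 * Real.exp 1 * (1 + |Δ|) * |t|) :=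
          mul_le_mul_of_nonneg_left h1 (by positivity)


/-- **K2 PROVED (work-order W7): far-field decay of the symmetrised filtered kernel**, unconditionally, with
`c = 2`, `v = 16e(1+|Δ|)`, `μ = 1`, `C_LR = e²`: HK06 time side (`timeSideBound_holds`, Part T) +
bond-current Lieb–Robinson bound (`bondCurrentLiebRobinson_holds`, Parts AB–AC) + scalar Laplace lemma
(`laplaceSinLemma_holds`). -/
theorem farFieldKernelDecay_holds (Δ : ℝ) (M : ℕ → ℝ) : FarFieldKernelDecay Δ M :=
  farFieldKernelDecay_of_LR Δ M (bondCurrentLiebRobinson_holds Δ) laplaceSinLemma_holds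

end Summit.HubbardSuperconductivity.HubbardSuperconductivity.Theorems.AnisotropyChord.Stiffness
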